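import Literature.MathematicalPhysics.QuantumLattice.HubbardLSMFillingProofs
import Literature.MathematicalPhysics.QuantumLattice.FermionLiebRobinson
import Literature.MathematicalPhysics.QuantumLattice.ApproximateEigenvectorLemmas
import HarnessLib

/-!
# Charges, slabs, the unit translation and boundary currents for the Hubbard model on the torus

Model layer for the Lieb–Schultz–Mattis case (§3.2, Example 2) of Bachmann–Bols–De Roeck–Fraas,
*A many-body index for quantum charge transport*, Comm. Math. Phys. **375** (2019) 1249 (BBDF),
for the grand-canonical Hubbard Hamiltonian `hubbardTorusWith d L t U μ` on the fermionic torus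
`FermionTorus d L ≅ ℤ_L^d` with the conserved charges `Q_x = n_{xσ}` (`σ` fixed). Everything is
PROVED (definitions with bodies + theorems; no named facts):

* `circDist` — the periodic distance on `ℤ/L` of one coordinate, `1`-Lipschitz under `± 1`
  (`circDist_add_one_le`, `circDist_sub_one_le`), hence level functions
  `x ↦ min_{b ∈ T} circDist(x₁, b)` are `1`-Lipschitz along bonds (`inf_circDist_le_of_adj`; the
  input of the fermionic Lieb–Robinson bound `fermion_lieb_robinson_hamiltonianWith`).
* `setCharge σ X = Σ_{x∈X} n_{xσ}` (BBDF's `Q_X`): diagonal with natural entries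
  (`setCharge_eq_diagonal`), Hermitian, additive, commuting family, `‖Q_X‖ ≤ |X|`, even element of
  the CAR algebra of `X` (`setCharge_mem_carEvenSubalgebra`), **integer spectrum**
  `e^{2πiQ_X} = 1` (`exp_two_pi_I_smul_setCharge`, BBDF §4.4), the total charge on a joint sector
  `Q^σ_Λ ψ = N_σ ψ` (`setCharge_univ_mulVec_of_mem_szSector`), covariance under site bijections.
* `coordZ i₀`, `slab i₀ S` (BBDF's hyperplanes `[a]`, intervals, half-torus, strips, §2.1.1),
  `siteShift`/`transOp i₀` — the unit translation `x ↦ x + e_{i₀}` and its Fock-space unitary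
  (`= relabelOp (lsmShift i₀)` of `HubbardLSMFillingProofs`): `V Q_{slab S} Vᴴ = Q_{slab (S+1)}`
  (`transOp_mul_setCharge_mul_conjTranspose`), the unique gapped ground state is a translation
  eigenvector (`exists_transOp_mulVec_eq_smul`), expectations are translation invariant
  (`expect_transOp_conj`), and **the charge per transverse layer is `N_σ/L`**
  (`expect_setCharge_slab_zero`; BBDF §3.2 `⟨Ω, Q_{[0]}Ω⟩ = L⁻¹⟨Ω, Q_ΛΩ⟩`).
* `localHubbard G t U μ B = Σ_{supp Z ⊆ B} Φ_Z` (strictly local Hamiltonians, even, Hermitian;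
  `hamiltonianWith_sub_localHubbard`), **charge conservation term by term**
  (`commute_setCharge_hubbardTermOp`: `[Q^σ_X, Φ_Z] = 0` if `supp Z ⊆ X` or `supp Z ∩ X = ∅`, via
  the diagonal-charge lemma `diagonal_commute_creation_mul_annihilation`), hence
  `[Q^σ_X, H] = Σ_{Z crossing ∂X} [Q^σ_X, Φ_Z]` (`setCharge_commutator_hamiltonianWith`, BBDF §2.4
  "`[H,Q_Y]` is supported in `(∂Y)^R`"), each boundary commutator being even, local
  (`setCharge_commutator_hubbardTermOp_mem`), anti-Hermitian and of norm `≤ 4(2|t|+|U|+2|μ|)`.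

Design notes: the `DecidableEq (Orb (FermionTorus d L))` instance synthesised directly differs from
the one derived from the linear order (see `HubbardLSMFillingProofs`); identities `= (1 : Matrix)`
on the concrete torus are therefore proved through `mulVec` (`conjTranspose_transOp_mul_self`), and
site images are taken with `Finset.map` (no extra `DecidableEq` hypotheses, which break
`map_sum` for the relabelling `AlgEquiv`).

## References

* S. Bachmann, A. Bols, W. De Roeck, M. Fraas, Comm. Math. Phys. **375** (2019) 1249: §2.1.1,
  §2.2, §2.4 (charge conservation, Prop. 2.4), §2.5, §3.2 (Example 2), §4.4. [BachmannEtAl2019]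
* The tree: `HubbardLSMFillingProofs` (`lsmShift`, `relabelOp`, `coord_rel_of_adj`,
  `spinCount_eq_of_mem_szSector`, `HasSpectralGap.exists_mulVec_eq_smul`), `FermionLiebRobinson`
  (`hubbardTermOp`, `hubbardTermSupp`, `sum_hubbardTermOp`, `commute_hubbardTermOp_of_disjoint`),
  `FermionRelabelling` (`relabel_mapEquiv_numberOp`, `relabel_eq_relabelOp_conj`),
  `FermionOperators` (`numberAt_eq_diagonal`, `numberAt_idempotent`),
  `ApproximateEigenvectorLemmas` (`exp_two_pi_I_smul_of_mul_self_eq`, `expect_conjTranspose_mul_mul`).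
-/

noncomputable section

namespace Literature.MathematicalPhysics.QuantumLattice

open Matrix Complex Finset HubbardWave0
open scoped Matrix.Norms.L2Operator ComplexOrder

/-! ### The periodic distance on `ℤ/L` in one coordinate -/

section CircDist

variable {L : ℕ} [NeZero L]

/-- The periodic distance `min ((a - b) mod L, (b - a) mod L)` on `ℤ/L`. [folklore] -/
def circDist (a b : ZMod L) : ℕ := min (a - b).val (b - a).val

omit [NeZero L] in
/-- Symmetry. [folklore] -/
theorem circDist_comm (a b : ZMod L) : circDist a b = circDist b a := by
  rw [circDist, circDist, min_comm]

omit [NeZero L] in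
/-- `circDist a a = 0`. [folklore] -/
@[simp] theorem circDist_self (a : ZMod L) : circDist a a = 0 := by
  simp [circDist]

omit [NeZero L] in
/-- `(x + 1).val ≤ x.val + 1` in `ℤ/L`. [folklore] -/
theorem val_add_one_le (x : ZMod L) : (x + 1).val ≤ x.val + 1 := by
  calc (x + 1).val ≤ x.val + (1 : ZMod L).val := ZMod.val_add_le x 1
    _ ≤ x.val + 1 := by
        gcongr
        rw [ZMod.val_one_eq_one_mod]
        exact Nat.mod_le 1 L

/-- `(x - 1).val ≤ x.val` unless `x = 0`. [folklore] -/
theorem val_sub_one_le {x : ZMod L} (hx : x ≠ 0) : (x - 1).val ≤ x.val := by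
  have h1 : (1 : ZMod L).val ≤ x.val := by
    rw [ZMod.val_one_eq_one_mod]
    rcases Nat.lt_or_ge L 2 with hL | hL
    · interval_cases L
      · exact absurd rfl (NeZero.ne 0)
      · simp
    · rw [Nat.mod_eq_of_lt hL]
      exact Nat.one_le_iff_ne_zero.2 ((ZMod.val_ne_zero x).2 hx)
  rw [ZMod.val_sub h1]
  exact Nat.sub_le _ _

/-- **The periodic distance is `1`-Lipschitz under `a ↦ a + 1`.** [folklore] -/
theorem circDist_add_one_le (a b : ZMod L) : circDist (a + 1) b ≤ circDist a b + 1 := by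
  unfold circDist
  have h1 : (a + 1 - b).val ≤ (a - b).val + 1 := by
    rw [show a + 1 - b = (a - b) + 1 by ring]; exact val_add_one_le _
  by_cases hab : b - a = 0
  · -- `a = b`
    have hab' : a = b := (sub_eq_zero.1 hab).symm
    subst hab'
    simp only [sub_self, ZMod.val_zero, min_self, zero_add, add_sub_cancel_left]
    exact min_le_of_left_le (by rw [ZMod.val_one_eq_one_mod]; exact Nat.mod_le 1 L)
  · have h2 : (b - (a + 1)).val ≤ (b - a).val := by
      rw [show b - (a + 1) = (b - a) - 1 by ring]; exact val_sub_one_le hab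
    omega

/-- **The periodic distance is `1`-Lipschitz under `a ↦ a - 1`.** [folklore] -/
theorem circDist_sub_one_le (a b : ZMod L) : circDist (a - 1) b ≤ circDist a b + 1 := by
  unfold circDist
  have h1 : (b - (a - 1)).val ≤ (b - a).val + 1 := by
    rw [show b - (a - 1) = (b - a) + 1 by ring]; exact val_add_one_le _
  by_cases hab : a - b = 0
  · have hab' : a = b := sub_eq_zero.1 hab
    subst hab'
    simp only [sub_self, ZMod.val_zero, min_self, zero_add]
    refine min_le_of_right_le ?_
    rw [show a - (a - 1) = (1 : ZMod L) by ring, ZMod.val_one_eq_one_mod]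
    exact Nat.mod_le 1 L
  · have h2 : (a - 1 - b).val ≤ (a - b).val := by
      rw [show a - 1 - b = (a - b) - 1 by ring]; exact val_sub_one_le hab
    omega

/-- `circDist a b ≤ circDist (a + 1) b + 1`. [folklore] -/
theorem circDist_le_circDist_add_one (a b : ZMod L) : circDist a b ≤ circDist (a + 1) b + 1 := by
  have h := circDist_sub_one_le (a + 1) b
  rwa [add_sub_cancel_right] at h

end CircDist

/-! ### Charges of a set of sites -/

section Charges

variable {Λ : Type*} [LinearOrder Λ] [Fintype Λ]

/-- The spin-`σ` charge `Q^σ_X = Σ_{x ∈ X} n_{xσ}` of the site set `X`. (BBDF's `Q_X = Σ_{x∈X} Q_x`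
with the local charges `Q_x = n_{xσ}`, `Spec(Q_x) = {0,1} ⊆ ℤ`.) [cite: BachmannEtAl2019, §2.2] -/
def setCharge (σ : Fin 2) (X : Finset Λ) : Matrix (Finset (Orb Λ)) (Finset (Orb Λ)) ℂ :=
  ∑ x ∈ X, numberOp x σ

/-- The number of spin-`σ` orbitals of `X` occupied in the configuration `s`. [folklore] -/
def setCount (σ : Fin 2) (X : Finset Λ) (s : Finset (Orb Λ)) : ℕ := (X.filter fun x => orb x σ ∈ s).card

/-- **The charge is diagonal in the occupation basis**, with natural-number entries
`Q^σ_X |s⟩ = #{x ∈ X : (x,σ) ∈ s} |s⟩`. [folklore] -/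
theorem setCharge_eq_diagonal (σ : Fin 2) (X : Finset Λ) :
    setCharge σ X = diagonal fun s => ((setCount σ X s : ℕ) : ℂ) := by
  unfold setCharge setCount
  have h : ∀ x ∈ X, (numberOp x σ : Matrix (Finset (Orb Λ)) (Finset (Orb Λ)) ℂ) =
      diagonalAddMonoidHom (Finset (Orb Λ)) ℂ (fun s => if orb x σ ∈ s then (1 : ℂ) else 0) :=
    fun x _ => by
      rw [← numberAt_orb, numberAt_eq_diagonal]
      rfl
  rw [Finset.sum_congr rfl h, ← map_sum, diagonalAddMonoidHom_apply]
  congr 1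
  funext s
  rw [Finset.sum_apply, Finset.card_filter]
  push_cast
  rfl

/-- The charge of the empty set vanishes. [folklore] -/
@[simp] theorem setCharge_empty (σ : Fin 2) : setCharge σ (∅ : Finset Λ) = 0 := by
  simp [setCharge]

/-- Additivity over disjoint unions. [folklore] -/
theorem setCharge_union {σ : Fin 2} {X Y : Finset Λ} (h : Disjoint X Y) :
    setCharge σ (X ∪ Y) = setCharge σ X + setCharge σ Y := by
  rw [setCharge, Finset.sum_union h, setCharge, setCharge]

/-- Monotone decomposition: `Q_Y = Q_X + Q_{Y ∖ X}` for `X ⊆ Y`. [folklore] -/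
theorem setCharge_eq_add_sdiff {σ : Fin 2} {X Y : Finset Λ} (h : X ⊆ Y) :
    setCharge σ Y = setCharge σ X + setCharge σ (Y \ X) := by
  rw [← setCharge_union Finset.disjoint_sdiff, Finset.union_sdiff_of_subset h]

/-- The charges are Hermitian. [folklore] -/
theorem isHermitian_setCharge (σ : Fin 2) (X : Finset Λ) : (setCharge σ X).IsHermitian := by
  rw [setCharge_eq_diagonal]
  refine Matrix.isHermitian_diagonal_of_self_adjoint _ (funext fun s => ?_)
  simp

/-- Charges commute with each other (they are simultaneously diagonal). [folklore] -/
theorem commute_setCharge (σ σ' : Fin 2) (X Y : Finset Λ) : Commute (setCharge σ X) (setCharge σ' Y) := by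
  rw [setCharge_eq_diagonal, setCharge_eq_diagonal, Commute, SemiconjBy, diagonal_mul_diagonal,
    diagonal_mul_diagonal]
  congr 1
  funext s
  ring

/-- **Integer spectrum**: `e^{2πi Q^σ_X} = 1`. (BBDF: `Spec(Q_x) ⊆ ℤ`, hence
`e^{2πi Q_X} = 1` — the identity used at `φ = 2π` in §4.4.) [cite: BachmannEtAl2019, §4.4] -/
theorem exp_two_pi_I_smul_setCharge (σ : Fin 2) (X : Finset Λ) :
    NormedSpace.exp ((2 * Real.pi * I) • setCharge σ X) = 1 := by
  classical
  induction X using Finset.induction_on with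
  | empty => simp [setCharge, NormedSpace.exp_zero]
  | insert x X hx ih =>
    have hsplit : setCharge σ (insert x X) = setCharge σ {x} + setCharge σ X := by
      rw [setCharge, Finset.sum_insert hx, setCharge, Finset.sum_singleton, setCharge]
    have hcomm : Commute ((2 * Real.pi * I) • setCharge σ ({x} : Finset Λ))
        ((2 * Real.pi * I) • setCharge σ X) :=
      ((commute_setCharge σ σ {x} X).smul_left _).smul_right _
    have hn : setCharge σ ({x} : Finset Λ) * setCharge σ {x} = setCharge σ {x} := by
      rw [setCharge, Finset.sum_singleton, ← numberAt_orb]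
      exact numberAt_idempotent _
    rw [hsplit, smul_add, Matrix.exp_add_of_commute _ _ hcomm, ih, Matrix.mul_one,
      exp_two_pi_I_smul_of_mul_self_eq hn]

/-- The charges are even elements of the CAR algebra of their sites. [folklore] -/
theorem setCharge_mem_carEvenSubalgebra (σ : Fin 2) (X : Finset Λ) :
    setCharge σ X ∈ carEvenSubalgebra (orbSet X) := by
  unfold setCharge
  refine Subalgebra.sum_mem _ fun x hx => ?_
  exact creation_mul_annihilation_mem_carEvenSubalgebra (orb_mem_orbSet hx σ) (orb_mem_orbSet hx σ)

/-- `‖Q^σ_X‖ ≤ |X|`. [folklore] -/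
theorem norm_setCharge_le (σ : Fin 2) (X : Finset Λ) : ‖setCharge σ X‖ ≤ X.card := by
  unfold setCharge
  calc ‖∑ x ∈ X, (numberOp x σ : Matrix (Finset (Orb Λ)) (Finset (Orb Λ)) ℂ)‖
      ≤ ∑ x ∈ X, ‖(numberOp x σ : Matrix (Finset (Orb Λ)) (Finset (Orb Λ)) ℂ)‖ := norm_sum_le _ _
    _ ≤ ∑ _x ∈ X, (1 : ℝ) := Finset.sum_le_sum fun x _ => norm_numberOp_le_one x σ
    _ = X.card := by simp

/-- **The total spin-`σ` charge on a joint sector**: for `ψ ∈ szSector N M`,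
`Q^σ_Λ ψ = N_σ ψ` with `N_↑ = N/2 + M`, `N_↓ = N/2 - M`. [folklore] -/
theorem setCharge_univ_mulVec_of_mem_szSector {N : ℕ} {M : ℝ} {ψ : Fock (Orb Λ)}
    (h : ψ ∈ szSector N M) (σ : Fin 2) :
    setCharge σ (Finset.univ : Finset Λ) *ᵥ ψ =
      ((if σ = 0 then (N : ℝ) / 2 + M else (N : ℝ) / 2 - M : ℝ) : ℂ) • ψ := by
  funext s
  rw [setCharge_eq_diagonal, mulVec_diagonal, Pi.smul_apply, smul_eq_mul]
  by_cases hs : ψ s = 0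
  · simp [hs]
  · obtain ⟨h0, h1⟩ := spinCount_eq_of_mem_szSector h hs
    have hcount : setCount σ (Finset.univ : Finset Λ) s = spinCount σ s := by
      rw [setCount, ← sum_ite_orb_mem σ s, Finset.card_filter]
    rw [hcount]
    congr 1
    fin_cases σ
    · simp only [Fin.zero_eta, Fin.isValue, ↓reduceIte]
      exact_mod_cast h0
    · simp only [Fin.mk_one, Fin.isValue, one_ne_zero, ↓reduceIte]
      exact_mod_cast h1

/-- **Charges are covariant under site bijections**: `Γ_f Q^σ_X Γ_f⁻¹ = Q^σ_{f(X)}`. [folklore] -/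
theorem relabel_mapEquiv_setCharge {Λ' : Type*} [LinearOrder Λ'] [Fintype Λ']
    (f : Λ ≃ Λ') (σ : Fin 2) (X : Finset Λ) :
    relabel (Orb.mapEquiv f) (setCharge σ X) = setCharge σ (X.map f.toEmbedding) := by
  rw [setCharge, map_sum, setCharge, Finset.sum_map]
  exact Finset.sum_congr rfl fun x _ => relabel_mapEquiv_numberOp f x σ

end Charges

/-! ### The coordinate `x₁`, slabs, and the unit translation of the fermionic torus -/

section Torus

open FermionTorus

variable {d L : ℕ}

/-- The distinguished coordinate `x_{i₀} ∈ ℤ/L` of a site of the fermionic torus `ℤ_L^d`.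
[folklore] -/
def coordZ (i₀ : Fin d) (x : FermionTorus d L) : ZMod L := ((ofLex x i₀ : ℕ) : ZMod L)

/-- **Adjacent sites have equal or consecutive `x₁`-coordinates.** [folklore] -/
theorem coordZ_rel_of_adj (i₀ : Fin d) {u v : FermionTorus d L} (h : (fermionTorusGraph d L).Adj u v) :
    coordZ i₀ u = coordZ i₀ v ∨ coordZ i₀ v = coordZ i₀ u + 1 ∨ coordZ i₀ u = coordZ i₀ v + 1 := by
  rcases coord_rel_of_adj i₀ h with h | h | h
  · exact Or.inl h
  · exact Or.inr (Or.inl (by rw [coordZ, coordZ, h, Nat.cast_succ]))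
  · exact Or.inr (Or.inr (by rw [coordZ, coordZ, h, Nat.cast_succ]))

/-- **Level functions of the `x₁`-coordinate are `1`-Lipschitz along bonds**: for any set `T` of
coordinate values, `x ↦ min_{b ∈ T} circDist (x₁, b)` changes by at most one across a bond.
[folklore] -/
theorem inf_circDist_le_of_adj [NeZero L] (i₀ : Fin d) {T : Finset (ZMod L)} (hT : T.Nonempty)
    {u v : FermionTorus d L} (h : (fermionTorusGraph d L).Adj u v) :
    T.inf' hT (fun b => circDist (coordZ i₀ u) b) ≤ T.inf' hT (fun b => circDist (coordZ i₀ v) b) + 1 := by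
  obtain ⟨b, hb, hmin⟩ := Finset.exists_mem_eq_inf' hT (fun b => circDist (coordZ i₀ v) b)
  rw [hmin]
  refine (Finset.inf'_le _ hb).trans ?_
  rcases coordZ_rel_of_adj i₀ h with e | e | e
  · rw [e]; exact Nat.le_succ _
  · rw [e]; exact circDist_le_circDist_add_one _ _
  · rw [e]; exact circDist_add_one_le _ _

/-- The slab `{x : x_{i₀} ∈ S}` of the torus over a set `S ⊆ ℤ/L` of coordinate values (BBDF's
hyperplanes `[a]`, intervals `[a, b]`, half-torus `Γ` and strips `S_±`). [cite: BachmannEtAl2019, §2.1.1] -/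
def slab (i₀ : Fin d) (S : Finset (ZMod L)) : Finset (FermionTorus d L) :=
  Finset.univ.filter fun x => coordZ i₀ x ∈ S

/-- Membership in a slab. [folklore] -/
@[simp] theorem mem_slab {i₀ : Fin d} {S : Finset (ZMod L)} {x : FermionTorus d L} :
    x ∈ slab i₀ S ↔ coordZ i₀ x ∈ S := by
  simp [slab]

/-- Slabs over disjoint coordinate sets are disjoint. [folklore] -/
theorem disjoint_slab {i₀ : Fin d} {S T : Finset (ZMod L)} (h : Disjoint S T) :
    Disjoint (slab i₀ S) (slab i₀ T : Finset (FermionTorus d L)) := by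
  rw [Finset.disjoint_left]
  intro x hx hx'
  rw [mem_slab] at hx hx'
  exact Finset.disjoint_left.1 h hx hx'

/-- Slabs are additive in the coordinate set. [folklore] -/
theorem slab_union (i₀ : Fin d) (S T : Finset (ZMod L)) :
    (slab i₀ (S ∪ T) : Finset (FermionTorus d L)) = slab i₀ S ∪ slab i₀ T := by
  ext x; simp [mem_slab]

/-- Slabs are monotone. [folklore] -/
theorem slab_mono (i₀ : Fin d) {S T : Finset (ZMod L)} (h : S ⊆ T) :
    (slab i₀ S : Finset (FermionTorus d L)) ⊆ slab i₀ T := fun x hx => by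
  rw [mem_slab] at hx ⊢; exact h hx

/-- The slab over all coordinate values is the whole torus. [folklore] -/
theorem slab_univ [NeZero L] (i₀ : Fin d) :
    (slab i₀ (Finset.univ : Finset (ZMod L)) : Finset (FermionTorus d L)) = Finset.univ := by
  ext x; simp [mem_slab]

variable [NeZero L]

/-- The unit translation `x ↦ x + e_{i₀}` of the torus as a site bijection (`lsmShift i₀` is the
induced orbital bijection). [folklore] -/
def siteShift (i₀ : Fin d) : FermionTorus d L ≃ FermionTorus d L :=
  ofTorusEquiv (Equiv.addRight (Pi.single i₀ (1 : ZMod L)))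

/-- `lsmShift` is the orbital map of `siteShift`. [folklore] -/
theorem lsmShift_eq_mapEquiv (i₀ : Fin d) : lsmShift (L := L) i₀ = Orb.mapEquiv (siteShift i₀) := rfl

/-- **The translation raises the coordinate by one.** [folklore] -/
theorem coordZ_siteShift (i₀ : Fin d) (x : FermionTorus d L) :
    coordZ i₀ (siteShift i₀ x) = coordZ i₀ x + 1 := by
  have h := coord_lsmShift i₀ (orb x 0)
  have e : (ofLex (lsmShift i₀ (orb x 0))).1 = siteShift i₀ x := rfl
  rw [e] at h
  change ((ofLex (siteShift i₀ x) i₀ : ℕ) : ZMod L) = ((ofLex x i₀ : ℕ) : ZMod L) + 1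
  rw [h, ZMod.natCast_mod, Nat.cast_succ]
  rfl

/-- The translation maps the slab over `S` onto the slab over `S + 1`. [folklore] -/
theorem map_siteShift_slab (i₀ : Fin d) (S : Finset (ZMod L)) :
    (slab i₀ S).map (siteShift (L := L) i₀).toEmbedding = slab i₀ (S.image fun a => a + 1) := by
  ext y
  simp only [Finset.mem_map_equiv, Finset.mem_image, mem_slab]
  have h2 := coordZ_siteShift i₀ ((siteShift i₀).symm y)
  rw [Equiv.apply_symm_apply] at h2
  constructor
  · intro hy
    refine ⟨coordZ i₀ ((siteShift i₀).symm y), hy, h2.symm⟩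
  · rintro ⟨a, ha, hay⟩
    have : coordZ i₀ ((siteShift i₀).symm y) = a := by
      have e := congrArg (fun z => z - 1) h2
      simp only [add_sub_cancel_right] at e
      rw [← e, ← hay, add_sub_cancel_right]
    change coordZ i₀ ((siteShift i₀).symm y) ∈ S
    rwa [this]

/-- The translation unitary `V = Γ_{lsmShift i₀}` on Fock space. [folklore] -/
def transOp (i₀ : Fin d) : Matrix (Finset (Orb (FermionTorus d L))) (Finset (Orb (FermionTorus d L))) ℂ :=
  relabelOp (lsmShift (L := L) i₀)

/-- `Vᴴ (V v) = v`. [folklore] -/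
theorem conjTranspose_transOp_mulVec_mulVec (i₀ : Fin d) (v : Fock (Orb (FermionTorus d L))) :
    (transOp (L := L) i₀)ᴴ *ᵥ (transOp i₀ *ᵥ v) = v :=
  conjTranspose_relabelOp_mulVec_mulVec _ v

/-- `Vᴴ V = 1` (stated with the ambient instances of the torus; proved through `mulVec`, cf. the
`DecidableEq` caveat in the module docstring of `HubbardLSMFillingProofs`). [folklore] -/
theorem conjTranspose_transOp_mul_self (i₀ : Fin d) : (transOp (L := L) i₀)ᴴ * transOp i₀ = 1 := by
  refine Matrix.toLin'.injective (LinearMap.ext fun v => ?_)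
  rw [Matrix.toLin'_apply, Matrix.toLin'_apply, ← mulVec_mulVec, one_mulVec]
  exact conjTranspose_transOp_mulVec_mulVec i₀ v

/-- `V Vᴴ = 1`. [folklore] -/
theorem transOp_mul_conjTranspose_self (i₀ : Fin d) : transOp (L := L) i₀ * (transOp i₀)ᴴ = 1 :=
  mul_eq_one_comm.1 (conjTranspose_transOp_mul_self i₀)

/-- The translation commutes with the torus Hubbard Hamiltonian. [folklore] -/
theorem transOp_mul_hubbardTorusWith (i₀ : Fin d) (t U μ : ℝ) :
    transOp (L := L) i₀ * hubbardTorusWith d L t U μ = hubbardTorusWith d L t U μ * transOp i₀ :=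
  relabelOp_lsmShift_mul_hubbardTorusWith i₀ t U μ

/-- **The translation shifts the charges**: `V Q^σ_{slab S} Vᴴ = Q^σ_{slab (S+1)}`. [folklore] -/
theorem transOp_mul_setCharge_mul_conjTranspose (i₀ : Fin d) (σ : Fin 2)
    (S : Finset (ZMod L)) :
    transOp i₀ * setCharge σ (slab i₀ S) * (transOp (L := L) i₀)ᴴ =
      setCharge σ (slab i₀ (S.image fun a => a + 1)) := by
  rw [transOp, ← relabel_eq_relabelOp_conj, lsmShift_eq_mapEquiv, relabel_mapEquiv_setCharge,
    map_siteShift_slab]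

/-- **The unique ground state is a translation eigenvector**: `Vψ = λψ` with `|λ| = 1`, and also
`Vᴴψ = λ⁻¹ψ`. [folklore] -/
theorem exists_transOp_mulVec_eq_smul (i₀ : Fin d) {t U μ g : ℝ}
    (hgap : (hubbardTorusWith d L t U μ).HasSpectralGap g)
    {ψ : Fock (Orb (FermionTorus d L))} (hψ : (hubbardTorusWith d L t U μ).IsGroundStateVector ψ) :
    ∃ lam : ℂ, ‖lam‖ = 1 ∧ transOp i₀ *ᵥ ψ = lam • ψ ∧ (transOp i₀)ᴴ *ᵥ ψ = lam⁻¹ • ψ := by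
  obtain ⟨c, hc⟩ := hgap.exists_mulVec_eq_smul (transOp_mul_hubbardTorusWith i₀ t U μ) hψ
  have hψ0 : ψ ≠ 0 := hψ.1
  have hnorm : star (transOp i₀ *ᵥ ψ) ⬝ᵥ (transOp i₀ *ᵥ ψ) = star ψ ⬝ᵥ ψ := by
    rw [star_mulVec, ← dotProduct_mulVec, conjTranspose_transOp_mulVec_mulVec]
  rw [hc, star_smul, smul_dotProduct, dotProduct_smul, smul_smul, smul_eq_mul] at hnorm
  have hψψ : star ψ ⬝ᵥ ψ ≠ 0 := by
    rw [star_dotProduct_self_eq_eucNorm_sq]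
    have : eucNorm ψ ≠ 0 := by
      intro h0
      apply hψ0
      have : (WithLp.toLp 2 ψ : EuclideanSpace ℂ (Finset (Orb (FermionTorus d L)))) = 0 := norm_eq_zero.1 h0
      exact (WithLp.toLp_eq_zero (p := 2)).1 this
    exact_mod_cast pow_ne_zero 2 this
  have hcc : star c * c = 1 := by
    have := mul_right_cancel₀ hψψ (hnorm.trans (one_mul _).symm)
    exact this
  have hcn : ‖c‖ = 1 := by
    have h := congrArg (fun z : ℂ => ‖z‖) hcc
    simp only [norm_mul, norm_star, norm_one] at h
    nlinarith [norm_nonneg c]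
  have hc0 : c ≠ 0 := fun h => by rw [h, norm_zero] at hcn; exact zero_ne_one hcn
  refine ⟨c, hcn, hc, ?_⟩
  have h2 : (transOp i₀)ᴴ *ᵥ (transOp i₀ *ᵥ ψ) = ψ := conjTranspose_transOp_mulVec_mulVec i₀ ψ
  rw [hc, mulVec_smul] at h2
  have := congrArg (fun v => c⁻¹ • v) h2
  simp only [smul_smul, inv_mul_cancel₀ hc0, one_smul] at this
  exact this

/-- **Translation invariance of ground-state expectations**: `⟨ψ, V X Vᴴ ψ⟩ = ⟨ψ, X ψ⟩`.
[folklore] -/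
theorem expect_transOp_conj (i₀ : Fin d) {t U μ g : ℝ}
    (hgap : (hubbardTorusWith d L t U μ).HasSpectralGap g)
    {ψ : Fock (Orb (FermionTorus d L))} (hψ : (hubbardTorusWith d L t U μ).IsGroundStateVector ψ)
    (X : Matrix (Finset (Orb (FermionTorus d L))) (Finset (Orb (FermionTorus d L))) ℂ) :
    star ψ ⬝ᵥ ((transOp i₀ * X * (transOp i₀)ᴴ) *ᵥ ψ) = star ψ ⬝ᵥ (X *ᵥ ψ) := by
  obtain ⟨lam, hlam, -, hVh⟩ := exists_transOp_mulVec_eq_smul i₀ hgap hψ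
  have h := expect_conjTranspose_mul_mul (U := (transOp (L := L) i₀)ᴴ) (X := X) hVh
    (by rw [norm_inv, hlam, inv_one])
  rwa [conjTranspose_conjTranspose] at h

/-- **All hyperplanes carry the same charge in the ground state**:
`⟨Q^σ_{[a]}⟩ = ⟨Q^σ_{[0]}⟩`. (BBDF §3.2: translation invariance.) [cite: BachmannEtAl2019, §3.2] -/
theorem expect_setCharge_slab_singleton_eq (i₀ : Fin d) {t U μ g : ℝ}
    (hgap : (hubbardTorusWith d L t U μ).HasSpectralGap g)
    {ψ : Fock (Orb (FermionTorus d L))} (hψ : (hubbardTorusWith d L t U μ).IsGroundStateVector ψ)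
    (σ : Fin 2) (a : ZMod L) :
    star ψ ⬝ᵥ (setCharge σ (slab i₀ {a}) *ᵥ ψ) = star ψ ⬝ᵥ (setCharge σ (slab i₀ {(0 : ZMod L)}) *ᵥ ψ) := by
  classical
  -- induction on the representative of `a`
  have key : ∀ n : ℕ, star ψ ⬝ᵥ (setCharge σ (slab i₀ {((n : ℕ) : ZMod L)}) *ᵥ ψ) =
      star ψ ⬝ᵥ (setCharge σ (slab i₀ {(0 : ZMod L)}) *ᵥ ψ) := by
    intro n
    induction n with
    | zero => simp
    | succ n ih =>
      rw [← ih, ← expect_transOp_conj i₀ hgap hψ (setCharge σ (slab i₀ {((n : ℕ) : ZMod L)})),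
        transOp_mul_setCharge_mul_conjTranspose, Finset.image_singleton, Nat.cast_succ]
  have ha : a = ((a.val : ℕ) : ZMod L) := (ZMod.natCast_zmod_val a).symm
  rw [ha]
  exact key a.val

/-- The hyperplane charges add up to the total charge. [folklore] -/
theorem sum_setCharge_slab_singleton (i₀ : Fin d) (σ : Fin 2) :
    ∑ a : ZMod L, setCharge σ (slab i₀ {a}) =
      setCharge σ (Finset.univ : Finset (FermionTorus d L)) := by
  classical
  unfold setCharge
  rw [← Finset.sum_biUnion]
  · congr 1
    ext x
    simp [mem_slab]
  · intro a _ b _ hab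
    exact disjoint_slab (Finset.disjoint_singleton.2 hab)

/-- **The charge per transverse layer is `N_σ / L`** (BBDF §1.2, Example 2 and §3.2:
`⟨Ω, Q_{[0]} Ω⟩ = L⁻¹ ⟨Ω, Q_Λ Ω⟩`): for the unique ground state in the joint sector
`szSector N M`, `⟨ψ, Q^σ_{[0]} ψ⟩ = (N_σ / L) ⟨ψ, ψ⟩` with `N_↑ = N/2 + M`, `N_↓ = N/2 - M`.
[cite: BachmannEtAl2019, §3.2] -/
theorem expect_setCharge_slab_zero (i₀ : Fin d) {t U μ g : ℝ}
    (hgap : (hubbardTorusWith d L t U μ).HasSpectralGap g)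
    {ψ : Fock (Orb (FermionTorus d L))} (hψ : (hubbardTorusWith d L t U μ).IsGroundStateVector ψ)
    {N : ℕ} {M : ℝ} (hmem : ψ ∈ szSector N M) (σ : Fin 2) :
    star ψ ⬝ᵥ (setCharge σ (slab i₀ {(0 : ZMod L)}) *ᵥ ψ) =
      (((if σ = 0 then (N : ℝ) / 2 + M else (N : ℝ) / 2 - M) / L : ℝ) : ℂ) * (star ψ ⬝ᵥ ψ) := by
  have hsum := congrArg (fun X => star ψ ⬝ᵥ (X *ᵥ ψ)) (sum_setCharge_slab_singleton (L := L) i₀ σ)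
  simp only [Matrix.sum_mulVec, dotProduct_sum] at hsum
  rw [Finset.sum_congr rfl fun a _ => expect_setCharge_slab_singleton_eq i₀ hgap hψ σ a,
    Finset.sum_const, Finset.card_univ, ZMod.card, nsmul_eq_mul,
    setCharge_univ_mulVec_of_mem_szSector hmem σ, dotProduct_smul, smul_eq_mul] at hsum
  have hL : (L : ℂ) ≠ 0 := by exact_mod_cast NeZero.ne L
  push_cast at hsum ⊢
  rw [div_mul_eq_mul_div, eq_div_iff hL]
  linear_combination hsum

end Torus

/-! ### Local Hamiltonians, charge conservation term by term, and boundary currents -/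

section LocalTerms

variable {Λ : Type*} [LinearOrder Λ] [Fintype Λ] (G : SimpleGraph Λ) [DecidableRel G.Adj]

/-- `orbSet` is monotone. [folklore] -/
theorem orbSet_mono {X Y : Finset Λ} (h : X ⊆ Y) : orbSet X ⊆ orbSet Y := fun k hk => by
  rw [mem_orbSet] at hk ⊢; exact h hk

/-- **The restriction of `H(t,U) - μN` to a region `B`**: the sum of the local terms supported in
`B` (BBDF's `G_± = Σ_{X ⊆ ∂_±^{L/12}} Φ_X`; here used as the strictly local Hamiltonian whose
dynamics localises the quasi-adiabatic generator). [cite: BachmannEtAl2019, §2.5] -/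
def localHubbard (t U μ : ℝ) (B : Finset Λ) : Matrix (Finset (Orb Λ)) (Finset (Orb Λ)) ℂ :=
  ∑ Z ∈ Finset.univ.filter (fun Z : HubbardIdx G => hubbardTermSupp G Z ⊆ B), hubbardTermOp G t U μ Z

/-- The local Hamiltonians are Hermitian. [folklore] -/
theorem isHermitian_localHubbard (t U μ : ℝ) (B : Finset Λ) : (localHubbard G t U μ B).IsHermitian :=
  isHermitian_finset_sum _ fun Z _ => isHermitian_hubbardTermOp G t U μ Z

/-- The local Hamiltonian of `B` is an even element of the CAR algebra of `B`. [folklore] -/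
theorem localHubbard_mem_carEvenSubalgebra (t U μ : ℝ) (B : Finset Λ) :
    localHubbard G t U μ B ∈ carEvenSubalgebra (orbSet B) := by
  unfold localHubbard
  refine Subalgebra.sum_mem _ fun Z hZ => ?_
  rw [Finset.mem_filter] at hZ
  exact carEvenSubalgebra_mono (orbSet_mono hZ.2) (hubbardTermOp_mem_carEvenSubalgebra G t U μ Z)

/-- **`H - H_B` is the sum of the terms not supported in `B`.** [folklore] -/
theorem hamiltonianWith_sub_localHubbard (t U μ : ℝ) (B : Finset Λ) :
    hamiltonianWith G t U μ - localHubbard G t U μ B =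
      ∑ Z ∈ Finset.univ.filter (fun Z : HubbardIdx G => ¬ hubbardTermSupp G Z ⊆ B),
        hubbardTermOp G t U μ Z := by
  rw [← sum_hubbardTermOp G t U μ, localHubbard, sub_eq_iff_eq_add, add_comm,
    Finset.sum_filter_add_sum_filter_not]

/-! #### Diagonal operators commute with charge-conserving hoppings -/

/-- **A diagonal operator commutes with the hopping `c†_i c_j` whenever its eigenvalue is the same
on `u ∪ {i}` and `u ∪ {j}`** (the only configurations the hopping connects). [folklore] -/
theorem diagonal_commute_creation_mul_annihilation {ι : Type*} [LinearOrder ι] [Fintype ι]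
    (f : Finset ι → ℂ) (i j : ι)
    (h : ∀ u : Finset ι, i ∉ u → j ∉ u → f (insert i u) = f (insert j u)) :
    Commute (diagonal f) (creation i * annihilation j) := by
  rw [Commute, SemiconjBy]
  ext s t
  rw [diagonal_mul, mul_diagonal]
  by_cases hst : f s = f t
  · rw [hst, mul_comm]
  · -- the matrix element vanishes
    have h0 : (creation i * annihilation j) s t = 0 := by
      rw [Matrix.mul_apply]
      refine Finset.sum_eq_zero fun u _ => ?_
      simp only [creation, conjTranspose_apply, annihilation]
      by_cases h1 : i ∉ u ∧ s = insert i u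
      · by_cases h2 : j ∉ u ∧ t = insert j u
        · exact absurd (by rw [h1.2, h2.2]; exact h u h1.1 h2.1) hst
        · rw [if_neg h2, mul_zero]
      · rw [if_neg h1, star_zero, zero_mul]
    rw [h0, mul_zero, zero_mul]

omit [Fintype Λ] in
/-- Adding an orbital `k ∉ u` to a configuration raises the `X`-count by `#{z ∈ X : (z,σ) = k}`.
[folklore] -/
theorem setCount_insert (σ : Fin 2) (X : Finset Λ) {k : Orb Λ} {u : Finset (Orb Λ)} (hk : k ∉ u) :
    setCount σ X (insert k u) = setCount σ X u + (X.filter fun z => orb z σ = k).card := by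
  unfold setCount
  have hsplit : (X.filter fun z => orb z σ ∈ insert k u) =
      (X.filter fun z => orb z σ ∈ u) ∪ (X.filter fun z => orb z σ = k) := by
    ext z
    simp only [Finset.mem_filter, Finset.mem_insert, Finset.mem_union]
    tauto
  have hdisj : Disjoint (X.filter fun z => orb z σ ∈ u) (X.filter fun z => orb z σ = k) := by
    rw [Finset.disjoint_filter]
    intro z _ hz hzk
    rw [hzk] at hz
    exact hk hz
  rw [hsplit, Finset.card_union_of_disjoint hdisj]

omit [Fintype Λ] in
/-- `#{z ∈ X : (z,σ) = (x,τ)} = [σ = τ ∧ x ∈ X]`. [folklore] -/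
theorem card_filter_orb_eq (σ τ : Fin 2) (X : Finset Λ) (x : Λ) :
    (X.filter fun z => orb z σ = orb x τ).card = if σ = τ ∧ x ∈ X then 1 else 0 := by
  by_cases hστ : σ = τ
  · subst hστ
    have : (X.filter fun z => orb z σ = orb x σ) = X.filter fun z => z = x := by
      refine Finset.filter_congr fun z _ => ?_
      rw [orb_eq_orb_iff]
      simp
    rw [this, Finset.filter_eq']
    by_cases hx : x ∈ X
    · simp [hx]
    · simp [hx]
  · have : (X.filter fun z => orb z σ = orb x τ) = ∅ := by
      refine Finset.filter_eq_empty_iff.2 fun z _ h => hστ (orb_eq_orb_iff.1 h).2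
    rw [this, Finset.card_empty, if_neg (fun h => hστ h.1)]

/-- **The charge `Q^σ_X` commutes with every hopping `c†_{(x,τ)} c_{(y,τ)}` with both or neither of
`x, y` in `X`** (charge conservation of the hopping across no boundary of `X`). [folklore] -/
theorem commute_setCharge_creation_mul_annihilation (σ τ : Fin 2) (X : Finset Λ) {x y : Λ}
    (hxy : (x ∈ X ↔ y ∈ X)) :
    Commute (setCharge σ X) (creation (orb x τ) * annihilation (orb y τ)) := by
  rw [setCharge_eq_diagonal]
  refine diagonal_commute_creation_mul_annihilation _ _ _ fun u hi hj => ?_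
  rw [setCount_insert σ X hi, setCount_insert σ X hj, card_filter_orb_eq, card_filter_orb_eq]
  simp only [hxy]

/-- Charges commute with number operators. [folklore] -/
theorem commute_setCharge_numberOp (σ τ : Fin 2) (X : Finset Λ) (x : Λ) :
    Commute (setCharge σ X) (numberOp x τ) := by
  have : (numberOp x τ : Matrix (Finset (Orb Λ)) (Finset (Orb Λ)) ℂ) = setCharge τ {x} := by
    simp [setCharge]
  rw [this]
  exact commute_setCharge σ τ X {x}

omit [DecidableRel G.Adj] in
/-- **Charge conservation term by term** (BBDF §2.4: `X ⊆ Y ⟹ [Φ_X, Q_Y] = 0`, and locality for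
disjoint supports): `[Q^σ_X, Φ_Z] = 0` whenever the support of the term `Z` lies inside `X` or
is disjoint from `X`. [cite: BachmannEtAl2019, §2.4] -/
theorem commute_setCharge_hubbardTermOp (t U μ : ℝ) (σ : Fin 2) (X : Finset Λ) (Z : HubbardIdx G)
    (hZ : hubbardTermSupp G Z ⊆ X ∨ Disjoint (hubbardTermSupp G Z) X) :
    Commute (setCharge σ X) (hubbardTermOp G t U μ Z) := by
  cases Z with
  | inl p =>
    have hxy : (p.1.1 ∈ X ↔ p.1.2 ∈ X) := by
      rcases hZ with h | h
      · exact ⟨fun _ => h (by simp [hubbardTermSupp]), fun _ => h (by simp [hubbardTermSupp])⟩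
      · constructor
        · intro hx; exact absurd hx (Finset.disjoint_left.1 h (by simp [hubbardTermSupp]))
        · intro hy; exact absurd hy (Finset.disjoint_left.1 h (by simp [hubbardTermSupp]))
    unfold hubbardTermOp
    refine Commute.smul_right (Commute.sum_right _ _ _ fun τ _ => Commute.add_right ?_ ?_) _
    · exact commute_setCharge_creation_mul_annihilation σ τ X hxy
    · exact commute_setCharge_creation_mul_annihilation σ τ X hxy.symm
  | inr x =>
    unfold hubbardTermOp
    refine Commute.sub_right (Commute.smul_right ((commute_setCharge_numberOp σ 0 X x).mul_right
      (commute_setCharge_numberOp σ 1 X x)) _) (Commute.smul_right ?_ _)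
    exact (commute_setCharge_numberOp σ 0 X x).add_right (commute_setCharge_numberOp σ 1 X x)

/-- The terms of `H` meeting both `X` and its complement ("crossing the boundary of `X`"). [folklore] -/
def crossing (X : Finset Λ) : Finset (HubbardIdx G) :=
  Finset.univ.filter fun Z => ¬ hubbardTermSupp G Z ⊆ X ∧ ¬ Disjoint (hubbardTermSupp G Z) X

/-- Membership in `crossing`. [folklore] -/
theorem mem_crossing {X : Finset Λ} {Z : HubbardIdx G} :
    Z ∈ crossing G X ↔ ¬ hubbardTermSupp G Z ⊆ X ∧ ¬ Disjoint (hubbardTermSupp G Z) X := by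
  simp [crossing]

/-- **The commutator of a charge with the Hamiltonian is a boundary term**:
`[Q^σ_X, H] = Σ_{Z crossing ∂X} [Q^σ_X, Φ_Z]` (BBDF §2.4: "`[H, Q_Y]` is supported in `(∂Y)^R`").
[cite: BachmannEtAl2019, §2.4] -/
theorem setCharge_commutator_hamiltonianWith (t U μ : ℝ) (σ : Fin 2) (X : Finset Λ) :
    setCharge σ X * hamiltonianWith G t U μ - hamiltonianWith G t U μ * setCharge σ X =
      ∑ Z ∈ crossing G X,
        (setCharge σ X * hubbardTermOp G t U μ Z - hubbardTermOp G t U μ Z * setCharge σ X) := by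
  rw [← sum_hubbardTermOp G t U μ, Finset.mul_sum, Finset.sum_mul, ← Finset.sum_sub_distrib,
    crossing, Finset.sum_filter]
  refine Finset.sum_congr rfl fun Z _ => ?_
  split_ifs with h
  · rfl
  · have h' : hubbardTermSupp G Z ⊆ X ∨ Disjoint (hubbardTermSupp G Z) X := by
      by_cases h1 : hubbardTermSupp G Z ⊆ X
      · exact Or.inl h1
      · by_cases h2 : Disjoint (hubbardTermSupp G Z) X
        · exact Or.inr h2
        · exact absurd ⟨h1, h2⟩ h
    exact sub_eq_zero.2 (commute_setCharge_hubbardTermOp G t U μ σ X Z h').eq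

omit [DecidableRel G.Adj] in
/-- The commutator of the charge with a single crossing term only involves the charge of the term's
own sites: `[Q^σ_X, Φ_Z] = [Q^σ_{X ∩ supp Z}, Φ_Z]`, an even element of the CAR algebra of
`supp Z`. [folklore] -/
theorem setCharge_commutator_hubbardTermOp_mem (t U μ : ℝ) (σ : Fin 2) (X : Finset Λ) (Z : HubbardIdx G) :
    setCharge σ X * hubbardTermOp G t U μ Z - hubbardTermOp G t U μ Z * setCharge σ X ∈
      carEvenSubalgebra (orbSet (hubbardTermSupp G Z)) := by
  classical
  set S := hubbardTermSupp G Z with hS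
  have hsplit : setCharge σ X = setCharge σ (X ∩ S) + setCharge σ (X \ S) := by
    rw [setCharge_eq_add_sdiff (Finset.inter_subset_left : X ∩ S ⊆ X), Finset.sdiff_inter_self_left]
  have hcomm : Commute (hubbardTermOp G t U μ Z) (setCharge σ (X \ S)) :=
    commute_hubbardTermOp_of_disjoint G t U μ Z
      ((carEvenSubalgebra_le_carSubalgebra _) (setCharge_mem_carEvenSubalgebra σ (X \ S)))
      (by rw [← hS]; exact Finset.disjoint_sdiff)
  have e : setCharge σ X * hubbardTermOp G t U μ Z - hubbardTermOp G t U μ Z * setCharge σ X =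
      setCharge σ (X ∩ S) * hubbardTermOp G t U μ Z - hubbardTermOp G t U μ Z * setCharge σ (X ∩ S) := by
    rw [hsplit, Matrix.add_mul, Matrix.mul_add, hcomm.eq]
    abel
  rw [e]
  have h1 : setCharge σ (X ∩ S) ∈ carEvenSubalgebra (orbSet S) :=
    carEvenSubalgebra_mono (orbSet_mono Finset.inter_subset_right) (setCharge_mem_carEvenSubalgebra σ _)
  have h2 : hubbardTermOp G t U μ Z ∈ carEvenSubalgebra (orbSet S) := hubbardTermOp_mem_carEvenSubalgebra G t U μ Z
  exact Subalgebra.sub_mem _ (Subalgebra.mul_mem _ h1 h2) (Subalgebra.mul_mem _ h2 h1)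

omit [DecidableRel G.Adj] in
/-- Norm of one boundary commutator: `‖[Q^σ_X, Φ_Z]‖ ≤ 4(2|t| + |U| + 2|μ|)`. [folklore] -/
theorem norm_setCharge_commutator_hubbardTermOp_le (t U μ : ℝ) (σ : Fin 2) (X : Finset Λ) (Z : HubbardIdx G) :
    ‖setCharge σ X * hubbardTermOp G t U μ Z - hubbardTermOp G t U μ Z * setCharge σ X‖ ≤
      4 * (2 * |t| + |U| + 2 * |μ|) := by
  classical
  set S := hubbardTermSupp G Z with hS
  have hsplit : setCharge σ X = setCharge σ (X ∩ S) + setCharge σ (X \ S) := by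
    rw [setCharge_eq_add_sdiff (Finset.inter_subset_left : X ∩ S ⊆ X), Finset.sdiff_inter_self_left]
  have hcomm : Commute (hubbardTermOp G t U μ Z) (setCharge σ (X \ S)) :=
    commute_hubbardTermOp_of_disjoint G t U μ Z
      ((carEvenSubalgebra_le_carSubalgebra _) (setCharge_mem_carEvenSubalgebra σ (X \ S)))
      (by rw [← hS]; exact Finset.disjoint_sdiff)
  have e : setCharge σ X * hubbardTermOp G t U μ Z - hubbardTermOp G t U μ Z * setCharge σ X =
      setCharge σ (X ∩ S) * hubbardTermOp G t U μ Z - hubbardTermOp G t U μ Z * setCharge σ (X ∩ S) := by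
    rw [hsplit, Matrix.add_mul, Matrix.mul_add, hcomm.eq]
    abel
  rw [e]
  have hcard : ((X ∩ S).card : ℝ) ≤ 2 := by
    have : (X ∩ S).card ≤ 2 := by
      refine (Finset.card_le_card Finset.inter_subset_right).trans ?_
      rw [hS]
      cases Z with
      | inl p => exact Finset.card_insert_le _ _ |>.trans (by simp)
      | inr x => simp [hubbardTermSupp]
    exact_mod_cast this
  have hQ : ‖setCharge σ (X ∩ S)‖ ≤ 2 := (norm_setCharge_le σ _).trans hcard
  have hΦ := norm_hubbardTermOp_le G t U μ Z
  calc ‖setCharge σ (X ∩ S) * hubbardTermOp G t U μ Z - hubbardTermOp G t U μ Z * setCharge σ (X ∩ S)‖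
      ≤ 2 * ‖setCharge σ (X ∩ S)‖ * ‖hubbardTermOp G t U μ Z‖ := norm_commutator_le _ _
    _ ≤ 2 * 2 * (2 * |t| + |U| + 2 * |μ|) := by gcongr
    _ = 4 * (2 * |t| + |U| + 2 * |μ|) := by ring

omit [DecidableRel G.Adj] in
/-- The boundary commutators are anti-Hermitian. [folklore] -/
theorem conjTranspose_setCharge_commutator_hubbardTermOp (t U μ : ℝ) (σ : Fin 2) (X : Finset Λ)
    (Z : HubbardIdx G) :
    (setCharge σ X * hubbardTermOp G t U μ Z - hubbardTermOp G t U μ Z * setCharge σ X)ᴴ =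
      -(setCharge σ X * hubbardTermOp G t U μ Z - hubbardTermOp G t U μ Z * setCharge σ X) := by
  rw [conjTranspose_sub, conjTranspose_mul, conjTranspose_mul, (isHermitian_setCharge σ X).eq,
    (isHermitian_hubbardTermOp G t U μ Z).eq, neg_sub]

end LocalTerms

end Literature.MathematicalPhysics.QuantumLattice

end
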